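import Mathlib.Analysis.InnerProductSpace.PiL2
import Mathlib.Algebra.Order.BigOperators.Ring.Finset
import Literature.Analysis.Fourier.LatticeTransportCommutator
import Literature.Analysis.FunctionSpaces.FlatTorus
import HarnessLib

/-!
# The lattice transport flux in SYMMETRISED form: `Re ⟨u, (b·∇) ω(D) u⟩ = ½ Re ⟨u, [b·∇, ω(D)] u⟩`
# and its bound by the Lipschitz constant of the weight times the gradient Wiener norm of the drift

Analysis/Fourier support file (everything proved; no definitions, no named facts).  Companion of
`Literature.Analysis.Fourier.LatticeTransportCommutator`.  On the Fourier side of `𝕋^d`, the transport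
flux of a real, divergence-free, band-limited drift `b = Σ_{j∈J} b̂_j e_j` into a WEIGHTED energy
`Σ_k ω_k ‖û(k)‖²` is the finite sum
`Fl(ω) = Σ_k ω_k Re Σ_a 2πi k_a ⟪𝓕(b_a u)(k), û(k)⟫ = Re Σ_k Σ_{j∈J} ω_k μ_j(k) ⟪û(k − j), û(k)⟫`,
`μ_j(k) = 2πi Σ_a k_a conj(b̂_{j,a})` (product ↔ convolution, `PassiveVectorTensorBandFluxShift`).
Reality `b̂_{−j} = conj b̂_j` and incompressibility `Σ_a j_a b̂_{j,a} = 0` give the two symbol rules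
`μ_j(k − j) = μ_j(k)` and `μ_{−j} = −conj μ_j`, under which the re-indexing `(k, j) ↦ (k − j, −j)` shows
`Re Σ_k Σ_j ω_{k−j} μ_j(k) ⟪û(k−j), û(k)⟫ = − Re Σ_k Σ_j ω_k μ_j(k) ⟪û(k−j), û(k)⟫`
— the lattice form of `⟨v, (b·∇)v⟩ = 0` — hence the SYMMETRISED identity
`Fl(ω) = ½ Re Σ_k Σ_j (ω_k − ω_{k−j}) μ_j(k) ⟪û(k−j), û(k)⟫`
(skew-adjointness of `b·∇` and self-adjointness of the multiplier: `⟨u, (b·∇)ω(D)u⟩ = ½⟨u, [b·∇, ω(D)]u⟩`;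
Constantin–Foias 1988, Ch. 6 (6.15)–(6.17): `b(u,v,v) = 0`; DiPerna–Lions 1989, §II.1 Lemma II.1: the
commutator costs `∇b`).  Consequences:

* `abs_re_sum_le_half` — `|Fl(ω)| ≤ ½ Σ_k Σ_j |ω_k − ω_{k−j}| |μ_j(k)| ‖û(k−j)‖ ‖û(k)‖`;
* `abs_re_sum_le_of_lipschitz_sq` — for a weight Lipschitz in `|k|²`, `|ω_k − ω_{k′}| ≤ Λ ||k|² − |k′|²|`,
  and `|μ_j(k)| ≤ 2π B_j |k|`:  `|Fl(ω)| ≤ Λ · (2π Σ_j |j| B_j) · Σ_k |k|² ‖û(k)‖²`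
  (`(|k| + |k−j|)·min(|k|, |k−j|) ≤ 2|k||k−j|` and `2xy ≤ x² + y²` with shift invariance) — the weight may
  vary by `O(1)` across ALL frequencies provided it does so on the scale `|k|²`, and the flux then costs
  only the gradient Wiener norm `2π Σ_j |j| ‖b̂_j‖` of the drift times the `H¹` energy: the input of
  dissipation-weighted Lyapunov functionals `Σ_k g(|k|², t) ‖û(k, t)‖²` for advection–diffusion;
* `transportSymbol_sub`, `transportSymbol_neg`, `norm_transportSymbol_le` — the two symbol rules and the
  bound `|μ_j(k)| ≤ 2π ‖b̂_j‖ |k|` for the concrete symbol of a real divergence-free drift;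
* `weightedFlux_eq_re_sum`, **`abs_weightedFlux_le`** — the same statements for the flux written exactly as
  it comes out of the weighted Galerkin identity (`Σ_k ω_k Re Σ_a 2πi k_a ⟪Σ_j b̂_{j,a} • û(k−j), û(k)⟫`).

All sums are finite: `ω` is supported in `F`, the drift in `J = −J`, and the bookkeeping set `K ⊇ F ∪ (F + J)`.
Consumer: cell `ad-ideate`, K1L_D `stmt-AnomalousDissipation-27980`, W3-E `stub_effectiveFrameEnergyL` (i)
(dissipation floor of the coarse window propagator: two-weight Lyapunov functional) and the thin-band ladder of (ii).

## Mathlib / tree search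
Tree: `LatticeTransportCommutator` (`sum_sq_shift_le`, `latticeCommutator`: the UNSYMMETRISED commutator bound,
which pays `‖k‖‖û(k)‖` against a band-localised Lipschitz symbol), `FunctionSpaces.Torus.latticeVec`;
`TorusTrigPoly.IsWeaklyDivFree.sum_mul_mFourierCoeff_eq_zero` / `isConjSymm_mFourierCoeff` supply the two
hypotheses for a real weakly divergence-free carrier.  Mathlib: `Finset.sum_nbij'`, `Finset.sum_subset`,
`inner_smul_left`, `sum_inner`, `inner_conj_symm`, `norm_inner_le_norm`; no symmetrised transport-flux lemma
(`rg "skew" Literature/Analysis/Fourier`, `rg trilinear Literature/Analysis/Fourier`: unrelated).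

## References
* P. Constantin, C. Foias, *Navier–Stokes Equations* (Chicago 1988), Ch. 6, (6.15)–(6.17) (`b(u,v,v) = 0`). [`ConstantinFoias1988`]
* R. J. DiPerna, P.-L. Lions, Invent. Math. 98 (1989), §II.1, Lemma II.1. [`DiPernaLions1989`]
-/

noncomputable section

open Finset Complex
open scoped BigOperators InnerProductSpace ComplexConjugate

namespace Literature.Analysis.Fourier

namespace LatticeFlux

variable {d : Type*} [Fintype d] {E : Type*} [NormedAddCommGroup E] [InnerProductSpace ℂ E]

/-! ## §1 Re-indexing of complete finite sums on the lattice -/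

section Reindex

variable {ι : Type*} [AddCommGroup ι] {M : Type*} [AddCommMonoid M]

/-- A finite sum that already contains the support of `g` AND its `j`-translate is shift invariant:
`Σ_{k∈K} g(k − j) = Σ_{k∈K} g(k)` (file-local helper). [folklore] -/
private theorem sum_sub_eq_sum [DecidableEq ι] (K : Finset ι) (j : ι) (g : ι → M) (hg : ∀ k, g k ≠ 0 → k ∈ K)
    (hg' : ∀ k, g k ≠ 0 → k + j ∈ K) : ∑ k ∈ K, g (k - j) = ∑ k ∈ K, g k := by
  have hinj : Set.InjOn (fun k : ι => k - j) (K : Set ι) := fun a _ b _ h => by simpa using h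
  rw [← Finset.sum_image (f := g) hinj]
  have h1 : ∑ k ∈ K.image (fun k => k - j), g k = ∑ k ∈ K ∪ K.image (fun k => k - j), g k := by
    refine Finset.sum_subset Finset.subset_union_right fun x _ hx => ?_
    by_contra h
    exact hx (Finset.mem_image.2 ⟨x + j, hg' x h, by simp⟩)
  have h2 : ∑ k ∈ K, g k = ∑ k ∈ K ∪ K.image (fun k => k - j), g k := by
    refine Finset.sum_subset Finset.subset_union_left fun x _ hx => ?_
    by_contra h
    exact hx (hg x h)
  rw [h1, h2]

/-- A symmetric index set is invariant under `j ↦ −j`: `Σ_{j∈J} g(−j) = Σ_{j∈J} g(j)` (file-local helper). [folklore] -/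
private theorem sum_neg_eq_sum (J : Finset ι) (hJ : ∀ j ∈ J, -j ∈ J) (g : ι → M) :
    ∑ j ∈ J, g (-j) = ∑ j ∈ J, g j :=
  Finset.sum_nbij' (fun j => -j) (fun j => -j) (fun j hj => hJ j hj) (fun j hj => hJ j hj)
    (fun j _ => neg_neg j) (fun j _ => neg_neg j) (fun _ _ => rfl)

end Reindex

/-! ## §2 The symmetrised flux identity for an abstract transport symbol -/

section Abstract

variable (K F J : Finset (d → ℤ)) (ω : (d → ℤ) → ℝ) (μ : (d → ℤ) → (d → ℤ) → ℂ) (X : (d → ℤ) → E)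

/-- **Reflection.**  For a real weight `ω` supported in `F`, a symmetric drift support `J`, a bookkeeping set
`K ⊇ F ∪ (F + J)` and a transport symbol with `μ_j(k − j) = μ_j(k)` (incompressibility) and
`μ_{−j} = −conj μ_j` (reality):
`Re Σ_{k∈K} Σ_{j∈J} ω_{k−j} μ_j(k) ⟪X(k−j), X(k)⟫ = − Re Σ_{k∈K} Σ_{j∈J} ω_k μ_j(k) ⟪X(k−j), X(k)⟫`
— the lattice form of `⟨v, (b·∇) v⟩ = 0` (re-index `(k, j) ↦ (k − j, −j)`).
[cite: ConstantinFoias1988, Ch. 6 (6.15)] -/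
theorem re_sum_reflect (hω : ∀ k, ω k ≠ 0 → k ∈ F) (hFK : F ⊆ K) (hKJ : ∀ k ∈ F, ∀ j ∈ J, k + j ∈ K)
    (hJ : ∀ j ∈ J, -j ∈ J) (hμs : ∀ j ∈ J, ∀ k, μ j (k - j) = μ j k)
    (hμr : ∀ j ∈ J, ∀ k, μ (-j) k = -conj (μ j k)) :
    (∑ k ∈ K, ∑ j ∈ J, ((ω (k - j) : ℝ) : ℂ) * μ j k * ⟪X (k - j), X k⟫_ℂ).re =
      -(∑ k ∈ K, ∑ j ∈ J, ((ω k : ℝ) : ℂ) * μ j k * ⟪X (k - j), X k⟫_ℂ).re := by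
  -- shift `k ↦ k + j` inside each `j`-slice
  have step1 : ∀ j ∈ J, ∑ k ∈ K, ((ω (k - j) : ℝ) : ℂ) * μ j k * ⟪X (k - j), X k⟫_ℂ =
      ∑ k ∈ K, ((ω k : ℝ) : ℂ) * μ j (k + j) * ⟪X k, X (k + j)⟫_ℂ := by
    intro j hj
    have key := sum_sub_eq_sum K j (fun k' => ((ω k' : ℝ) : ℂ) * μ j (k' + j) * ⟪X k', X (k' + j)⟫_ℂ)
      (fun k hk => ?_) (fun k hk => ?_)
    · simpa only [sub_add_cancel] using key
    · have hk' : ω k ≠ 0 := fun h => hk (by simp [h])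
      exact hFK (hω k hk')
    · have hk' : ω k ≠ 0 := fun h => hk (by simp [h])
      exact hKJ k (hω k hk') j hj
  rw [Finset.sum_comm, Finset.sum_congr rfl step1]
  -- reflect `j ↦ -j`
  have step2 : ∑ j ∈ J, ∑ k ∈ K, ((ω k : ℝ) : ℂ) * μ j (k + j) * ⟪X k, X (k + j)⟫_ℂ =
      ∑ j ∈ J, ∑ k ∈ K, ((ω k : ℝ) : ℂ) * μ (-j) (k + -j) * ⟪X k, X (k + -j)⟫_ℂ :=
    (sum_neg_eq_sum J hJ (fun j => ∑ k ∈ K, ((ω k : ℝ) : ℂ) * μ j (k + j) * ⟪X k, X (k + j)⟫_ℂ)).symm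
  -- identify each term with minus the conjugate of the original one
  have step3 : ∀ j ∈ J, ∑ k ∈ K, ((ω k : ℝ) : ℂ) * μ (-j) (k + -j) * ⟪X k, X (k + -j)⟫_ℂ =
      -conj (∑ k ∈ K, ((ω k : ℝ) : ℂ) * μ j k * ⟪X (k - j), X k⟫_ℂ) := by
    intro j hj
    rw [map_sum, ← Finset.sum_neg_distrib]
    refine Finset.sum_congr rfl fun k _ => ?_
    rw [← sub_eq_add_neg, hμr j hj, hμs j hj, map_mul, map_mul, Complex.conj_ofReal, inner_conj_symm]
    ring
  rw [step2, Finset.sum_congr rfl step3]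
  conv_rhs => rw [Finset.sum_comm]
  simp only [Complex.re_sum, Complex.neg_re, Complex.conj_re, Finset.sum_neg_distrib]

/-- **The symmetrised flux identity.**  Under the hypotheses of `re_sum_reflect`,
`Re Σ_k Σ_j ω_k μ_j(k) ⟪X(k−j), X(k)⟫ = ½ Re Σ_k Σ_j (ω_k − ω_{k−j}) μ_j(k) ⟪X(k−j), X(k)⟫`
(`⟨u, (b·∇) ω(D) u⟩ = ½ ⟨u, [b·∇, ω(D)] u⟩`). [cite: ConstantinFoias1988, Ch. 6 (6.15)–(6.17)]
[cite: DiPernaLions1989, §II.1 Lemma II.1] -/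
theorem re_sum_eq_half (hω : ∀ k, ω k ≠ 0 → k ∈ F) (hFK : F ⊆ K) (hKJ : ∀ k ∈ F, ∀ j ∈ J, k + j ∈ K)
    (hJ : ∀ j ∈ J, -j ∈ J) (hμs : ∀ j ∈ J, ∀ k, μ j (k - j) = μ j k)
    (hμr : ∀ j ∈ J, ∀ k, μ (-j) k = -conj (μ j k)) :
    (∑ k ∈ K, ∑ j ∈ J, ((ω k : ℝ) : ℂ) * μ j k * ⟪X (k - j), X k⟫_ℂ).re =
      1 / 2 * (∑ k ∈ K, ∑ j ∈ J, ((ω k - ω (k - j) : ℝ) : ℂ) * μ j k * ⟪X (k - j), X k⟫_ℂ).re := by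
  have h := re_sum_reflect K F J ω μ X hω hFK hKJ hJ hμs hμr
  have e : ∑ k ∈ K, ∑ j ∈ J, ((ω k - ω (k - j) : ℝ) : ℂ) * μ j k * ⟪X (k - j), X k⟫_ℂ =
      (∑ k ∈ K, ∑ j ∈ J, ((ω k : ℝ) : ℂ) * μ j k * ⟪X (k - j), X k⟫_ℂ) -
        ∑ k ∈ K, ∑ j ∈ J, ((ω (k - j) : ℝ) : ℂ) * μ j k * ⟪X (k - j), X k⟫_ℂ := by
    rw [← Finset.sum_sub_distrib]
    refine Finset.sum_congr rfl fun k _ => ?_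
    rw [← Finset.sum_sub_distrib]
    refine Finset.sum_congr rfl fun j _ => ?_
    push_cast
    ring
  rw [e, Complex.sub_re, h]
  ring

/-! ## §3 Bounds -/

/-- **Raw symmetrised bound**: `|Fl(ω)| ≤ ½ Σ_k Σ_j |ω_k − ω_{k−j}| · |μ_j(k)| · ‖X(k−j)‖ ‖X(k)‖`.
[cite: DiPernaLions1989, §II.1 Lemma II.1] -/
theorem abs_re_sum_le_half (hω : ∀ k, ω k ≠ 0 → k ∈ F) (hFK : F ⊆ K) (hKJ : ∀ k ∈ F, ∀ j ∈ J, k + j ∈ K)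
    (hJ : ∀ j ∈ J, -j ∈ J) (hμs : ∀ j ∈ J, ∀ k, μ j (k - j) = μ j k)
    (hμr : ∀ j ∈ J, ∀ k, μ (-j) k = -conj (μ j k)) :
    |(∑ k ∈ K, ∑ j ∈ J, ((ω k : ℝ) : ℂ) * μ j k * ⟪X (k - j), X k⟫_ℂ).re| ≤
      1 / 2 * ∑ k ∈ K, ∑ j ∈ J, |ω k - ω (k - j)| * ‖μ j k‖ * (‖X (k - j)‖ * ‖X k‖) := by
  rw [re_sum_eq_half K F J ω μ X hω hFK hKJ hJ hμs hμr, abs_mul, abs_of_pos (by norm_num : (0:ℝ) < 1 / 2)]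
  refine mul_le_mul_of_nonneg_left ?_ (by norm_num)
  refine (Complex.abs_re_le_norm _).trans ((norm_sum_le _ _).trans (Finset.sum_le_sum fun k _ => ?_))
  refine (norm_sum_le _ _).trans (Finset.sum_le_sum fun j _ => ?_)
  rw [norm_mul, norm_mul, Complex.norm_real, Real.norm_eq_abs]
  exact mul_le_mul_of_nonneg_left (norm_inner_le_norm _ _) (mul_nonneg (abs_nonneg _) (norm_nonneg _))

/-- `(x + y) · min(x, y) ≤ 2xy` for `x, y ≥ 0` (file-local helper). [folklore] -/
private theorem add_mul_min_le {x y : ℝ} (hx : 0 ≤ x) (hy : 0 ≤ y) : (x + y) * min x y ≤ 2 * (x * y) := by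
  rcases le_total x y with h | h
  · rw [min_eq_left h]; nlinarith
  · rw [min_eq_right h]; nlinarith

variable [DecidableEq d]

/-- **The `|k|²`-Lipschitz bound.**  If moreover `|ω_k − ω_{k′}| ≤ Λ · ||k|² − |k′|²|` (`Λ ≥ 0`) and
`|μ_j(k)| ≤ 2π B_j |k|` (`|k| = ‖latticeVec k‖`), then
`|Re Σ_{k∈K} Σ_{j∈J} ω_k μ_j(k) ⟪X(k−j), X(k)⟫| ≤ Λ · (2π Σ_{j∈J} |j| B_j) · Σ_{k∈K} |k|² ‖X(k)‖²`
— a weight varying by `O(1)` on the scale `|k|²` lets the drift move only `(strain) × (H¹ energy)`.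
[cite: DiPernaLions1989, §II.1 Lemma II.1] -/
theorem abs_re_sum_le_of_lipschitz_sq (hω : ∀ k, ω k ≠ 0 → k ∈ F) (hFK : F ⊆ K)
    (hKJ : ∀ k ∈ F, ∀ j ∈ J, k + j ∈ K) (hJ : ∀ j ∈ J, -j ∈ J) (hμs : ∀ j ∈ J, ∀ k, μ j (k - j) = μ j k)
    (hμr : ∀ j ∈ J, ∀ k, μ (-j) k = -conj (μ j k)) {Λ : ℝ} (hΛ : 0 ≤ Λ)
    (hωL : ∀ k k', |ω k - ω k'| ≤
      Λ * |‖FunctionSpaces.Torus.latticeVec k‖ ^ 2 - ‖FunctionSpaces.Torus.latticeVec k'‖ ^ 2|)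
    (B : (d → ℤ) → ℝ) (hB : ∀ j ∈ J, 0 ≤ B j)
    (hμb : ∀ j ∈ J, ∀ k, ‖μ j k‖ ≤ 2 * Real.pi * B j * ‖FunctionSpaces.Torus.latticeVec k‖) :
    |(∑ k ∈ K, ∑ j ∈ J, ((ω k : ℝ) : ℂ) * μ j k * ⟪X (k - j), X k⟫_ℂ).re| ≤
      Λ * (2 * Real.pi * ∑ j ∈ J, ‖FunctionSpaces.Torus.latticeVec j‖ * B j) *
        ∑ k ∈ K, ‖FunctionSpaces.Torus.latticeVec k‖ ^ 2 * ‖X k‖ ^ 2 := by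
  -- truncate `X` to `K`: the flux only reads `X` on `K`
  set X' : (d → ℤ) → E := fun k => if k ∈ K then X k else 0 with hX'
  have hX'K : ∀ k ∈ K, X' k = X k := fun k hk => by simp [hX', hk]
  have htrunc : ∑ k ∈ K, ∑ j ∈ J, ((ω k : ℝ) : ℂ) * μ j k * ⟪X (k - j), X k⟫_ℂ =
      ∑ k ∈ K, ∑ j ∈ J, ((ω k : ℝ) : ℂ) * μ j k * ⟪X' (k - j), X' k⟫_ℂ := by
    refine Finset.sum_congr rfl fun k hk => Finset.sum_congr rfl fun j hj => ?_
    by_cases h : ω k = 0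
    · simp [h]
    · have hkF : k ∈ F := hω k h
      have hkj : k - j ∈ K := by
        have := hKJ k hkF (-j) (hJ j hj); rwa [← sub_eq_add_neg] at this
      rw [hX'K k hk, hX'K (k - j) hkj]
  rw [htrunc]
  refine (abs_re_sum_le_half K F J ω μ X' hω hFK hKJ hJ hμs hμr).trans ?_
  -- abbreviations
  set nv : (d → ℤ) → ℝ := fun k => ‖FunctionSpaces.Torus.latticeVec k‖ with hnv
  set G : (d → ℤ) → ℝ := fun k => nv k * ‖X' k‖ with hG
  have hnv0 : ∀ k, 0 ≤ nv k := fun k => norm_nonneg _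
  have hG0 : ∀ k, 0 ≤ G k := fun k => mul_nonneg (hnv0 k) (norm_nonneg _)
  have hGK : ∀ k, k ∉ K → G k = 0 := fun k hk => by simp [hG, hX', hk]
  -- the difference of lattice norms is at most `|j|`
  have hdiff : ∀ k j : d → ℤ, |nv k - nv (k - j)| ≤ nv j := by
    intro k j
    have e : FunctionSpaces.Torus.latticeVec k - FunctionSpaces.Torus.latticeVec (k - j) =
        FunctionSpaces.Torus.latticeVec j := by
      ext i; simp [FunctionSpaces.Torus.latticeVec_apply]
    simpa [hnv, e] using abs_norm_sub_norm_le (FunctionSpaces.Torus.latticeVec k)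
      (FunctionSpaces.Torus.latticeVec (k - j))
  -- pointwise: `|ω_k − ω_{k−j}| |μ_j(k)| ≤ 4πΛ |j| B_j |k| |k−j|`
  have hpt : ∀ k ∈ K, ∀ j ∈ J, |ω k - ω (k - j)| * ‖μ j k‖ * (‖X' (k - j)‖ * ‖X' k‖) ≤
      4 * Real.pi * Λ * (nv j * B j) * (G k * G (k - j)) := by
    intro k hk j hj
    have h1 : |ω k - ω (k - j)| ≤ Λ * ((nv k + nv (k - j)) * nv j) := by
      refine (hωL k (k - j)).trans (mul_le_mul_of_nonneg_left ?_ hΛ)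
      rw [sq_sub_sq, abs_mul, abs_of_nonneg (add_nonneg (hnv0 _) (hnv0 _))]
      exact mul_le_mul_of_nonneg_left (hdiff k j) (add_nonneg (hnv0 _) (hnv0 _))
    have h2 : ‖μ j k‖ ≤ 2 * Real.pi * B j * min (nv k) (nv (k - j)) := by
      rcases le_total (nv k) (nv (k - j)) with h | h
      · rw [min_eq_left h]; exact hμb j hj k
      · rw [min_eq_right h, ← hμs j hj k]; exact hμb j hj (k - j)
    have h3 : |ω k - ω (k - j)| * ‖μ j k‖ ≤ 4 * Real.pi * Λ * (nv j * B j) * (nv k * nv (k - j)) := by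
      calc |ω k - ω (k - j)| * ‖μ j k‖
          ≤ (Λ * ((nv k + nv (k - j)) * nv j)) * (2 * Real.pi * B j * min (nv k) (nv (k - j))) :=
            mul_le_mul h1 h2 (norm_nonneg _) (mul_nonneg hΛ (by positivity))
        _ = 2 * Real.pi * Λ * (nv j * B j) * ((nv k + nv (k - j)) * min (nv k) (nv (k - j))) := by ring
        _ ≤ 2 * Real.pi * Λ * (nv j * B j) * (2 * (nv k * nv (k - j))) :=
            mul_le_mul_of_nonneg_left (add_mul_min_le (hnv0 _) (hnv0 _))
              (by have := hB j hj; positivity)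
        _ = 4 * Real.pi * Λ * (nv j * B j) * (nv k * nv (k - j)) := by ring
    calc |ω k - ω (k - j)| * ‖μ j k‖ * (‖X' (k - j)‖ * ‖X' k‖)
        ≤ (4 * Real.pi * Λ * (nv j * B j) * (nv k * nv (k - j))) * (‖X' (k - j)‖ * ‖X' k‖) :=
          mul_le_mul_of_nonneg_right h3 (by positivity)
      _ = 4 * Real.pi * Λ * (nv j * B j) * (G k * G (k - j)) := by simp only [hG]; ring
  -- `Σ_k G(k) G(k−j) ≤ Σ_k G(k)²` (`2xy ≤ x² + y²`, shift invariance)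
  have hshift : ∀ j : d → ℤ, ∑ k ∈ K, G k * G (k - j) ≤ ∑ k ∈ K, G k ^ 2 := by
    intro j
    have h1 : ∑ k ∈ K, G k * G (k - j) ≤ ∑ k ∈ K, (G k ^ 2 + G (k - j) ^ 2) / 2 :=
      Finset.sum_le_sum fun k _ => by nlinarith [sq_nonneg (G k - G (k - j))]
    refine h1.trans ?_
    rw [← Finset.sum_div, Finset.sum_add_distrib]
    have h2 := LatticeCommutator.sum_sq_shift_le K K G hGK j
    linarith
  -- assemble
  have hsum : ∑ k ∈ K, ∑ j ∈ J, |ω k - ω (k - j)| * ‖μ j k‖ * (‖X' (k - j)‖ * ‖X' k‖) ≤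
      ∑ j ∈ J, 4 * Real.pi * Λ * (nv j * B j) * ∑ k ∈ K, G k ^ 2 := by
    rw [Finset.sum_comm]
    refine Finset.sum_le_sum fun j hj => ?_
    refine (Finset.sum_le_sum fun k hk => hpt k hk j hj).trans ?_
    rw [← Finset.mul_sum]
    exact mul_le_mul_of_nonneg_left (hshift j) (by have := hB j hj; positivity)
  have hGsq : ∑ k ∈ K, G k ^ 2 = ∑ k ∈ K, nv k ^ 2 * ‖X k‖ ^ 2 := by
    refine Finset.sum_congr rfl fun k hk => ?_
    simp only [hG, hX'K k hk]; ring
  calc 1 / 2 * ∑ k ∈ K, ∑ j ∈ J, |ω k - ω (k - j)| * ‖μ j k‖ * (‖X' (k - j)‖ * ‖X' k‖)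
      ≤ 1 / 2 * ∑ j ∈ J, 4 * Real.pi * Λ * (nv j * B j) * ∑ k ∈ K, G k ^ 2 :=
        mul_le_mul_of_nonneg_left hsum (by norm_num)
    _ = Λ * (2 * Real.pi * ∑ j ∈ J, nv j * B j) * ∑ k ∈ K, nv k ^ 2 * ‖X k‖ ^ 2 := by
        rw [← hGsq, ← Finset.sum_mul, ← Finset.mul_sum]
        ring

end Abstract

/-! ## §4 The concrete transport symbol of a real divergence-free drift -/

section Concrete

variable (bhat : (d → ℤ) → EuclideanSpace ℂ d)

/-- **Incompressibility rule**: if `Σ_a j_a b̂_{j,a} = 0` then the symbol `μ_j(k) = 2πi Σ_a k_a conj(b̂_{j,a})`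
satisfies `μ_j(k − j) = μ_j(k)` (the derivative may be put on either factor). [cite: ConstantinFoias1988, Ch. 6 (6.15)] -/
theorem transportSymbol_sub {j : d → ℤ} (hdiv : ∑ a, (j a : ℂ) * bhat j a = 0) (k : d → ℤ) :
    (∑ a, 2 * Real.pi * I * ((k - j) a : ℂ) * conj (bhat j a)) =
      ∑ a, 2 * Real.pi * I * (k a : ℂ) * conj (bhat j a) := by
  have h0 : ∑ a, (j a : ℂ) * conj (bhat j a) = 0 := by
    have := congrArg conj hdiv
    rw [map_sum, map_zero] at this
    rw [← this]
    refine Finset.sum_congr rfl fun a _ => ?_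
    rw [map_mul, map_intCast]
  have e : ∀ a, 2 * Real.pi * I * ((k - j) a : ℂ) * conj (bhat j a) =
      2 * Real.pi * I * (k a : ℂ) * conj (bhat j a) - 2 * Real.pi * I * ((j a : ℂ) * conj (bhat j a)) := by
    intro a
    simp only [Pi.sub_apply, Int.cast_sub]
    ring
  simp_rw [e]
  rw [Finset.sum_sub_distrib, ← Finset.mul_sum, h0, mul_zero, sub_zero]

/-- **Reality rule**: if `b̂_{−j} = conj b̂_j` (componentwise) then `μ_{−j}(k) = −conj μ_j(k)`.
[cite: ConstantinFoias1988, Ch. 6 (6.15)] -/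
theorem transportSymbol_neg {j : d → ℤ} (hreal : ∀ a, bhat (-j) a = conj (bhat j a)) (k : d → ℤ) :
    (∑ a, 2 * Real.pi * I * (k a : ℂ) * conj (bhat (-j) a)) =
      -conj (∑ a, 2 * Real.pi * I * (k a : ℂ) * conj (bhat j a)) := by
  rw [map_sum, ← Finset.sum_neg_distrib]
  refine Finset.sum_congr rfl fun a _ => ?_
  rw [hreal a]
  simp only [map_mul, map_ofNat, Complex.conj_ofReal, Complex.conj_I, map_intCast, starRingEnd_self_apply]
  ring

variable [DecidableEq d]

/-- `‖latticeVec k‖² = Σ_a k_a²` (private twin of `FluidPDE.…norm_latticeVec_sq`, kept out of the import closure). [folklore] -/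
private theorem norm_latticeVec_sq' (k : d → ℤ) :
    ‖FunctionSpaces.Torus.latticeVec k‖ ^ 2 = ∑ a, ((k a : ℤ) : ℝ) ^ 2 := by
  rw [EuclideanSpace.norm_sq_eq]
  refine Finset.sum_congr rfl fun a _ => ?_
  rw [FunctionSpaces.Torus.latticeVec_apply, Real.norm_eq_abs, sq_abs]

/-- **Size of the symbol**: `|μ_j(k)| ≤ 2π ‖b̂_j‖ |k|` (Cauchy–Schwarz in `ℂ^d`; the size of the transport symbol
`b̂_j · 2πi k` entering the commutator estimate). [cite: DiPernaLions1989, §II.1 Lemma II.1] -/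
theorem norm_transportSymbol_le (j k : d → ℤ) :
    ‖∑ a, 2 * Real.pi * I * (k a : ℂ) * conj (bhat j a)‖ ≤
      2 * Real.pi * ‖bhat j‖ * ‖FunctionSpaces.Torus.latticeVec k‖ := by
  have h2pi : ‖(2 * Real.pi * I : ℂ)‖ = 2 * Real.pi := by
    rw [norm_mul, Complex.norm_I, mul_one]
    rw [show (2 * Real.pi : ℂ) = ((2 * Real.pi : ℝ) : ℂ) by push_cast; ring, Complex.norm_real,
      Real.norm_eq_abs, abs_of_pos Real.two_pi_pos]
  have e : (∑ a, 2 * Real.pi * I * (k a : ℂ) * conj (bhat j a)) =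
      (2 * Real.pi * I) * ∑ a, (k a : ℂ) * conj (bhat j a) := by
    rw [Finset.mul_sum]
    refine Finset.sum_congr rfl fun a _ => ?_
    ring
  rw [e, norm_mul, h2pi]
  suffices hmain : ‖∑ a, (k a : ℂ) * conj (bhat j a)‖ ≤ ‖bhat j‖ * ‖FunctionSpaces.Torus.latticeVec k‖ by
    calc 2 * Real.pi * ‖∑ a, (k a : ℂ) * conj (bhat j a)‖
        ≤ 2 * Real.pi * (‖bhat j‖ * ‖FunctionSpaces.Torus.latticeVec k‖) :=
          mul_le_mul_of_nonneg_left hmain Real.two_pi_pos.le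
      _ = 2 * Real.pi * ‖bhat j‖ * ‖FunctionSpaces.Torus.latticeVec k‖ := by ring
  -- Cauchy–Schwarz for the finite sum
  have hcs : ‖∑ a, (k a : ℂ) * conj (bhat j a)‖ ≤ ∑ a, |((k a : ℤ) : ℝ)| * ‖bhat j a‖ := by
    refine (norm_sum_le _ _).trans (Finset.sum_le_sum fun a _ => ?_)
    rw [norm_mul, Complex.norm_intCast, RCLike.norm_conj]
  refine hcs.trans ?_
  have hsq : (∑ a, |((k a : ℤ) : ℝ)| * ‖bhat j a‖) ^ 2 ≤
      (‖bhat j‖ * ‖FunctionSpaces.Torus.latticeVec k‖) ^ 2 := by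
    rw [mul_pow, EuclideanSpace.norm_sq_eq (bhat j), norm_latticeVec_sq' k, mul_comm]
    refine (Finset.sum_mul_sq_le_sq_mul_sq Finset.univ _ _).trans (le_of_eq ?_)
    congr 1
    exact Finset.sum_congr rfl fun a _ => sq_abs _
  have hl : 0 ≤ ∑ a, |((k a : ℤ) : ℝ)| * ‖bhat j a‖ :=
    Finset.sum_nonneg fun a _ => mul_nonneg (abs_nonneg _) (norm_nonneg _)
  have hr : 0 ≤ ‖bhat j‖ * ‖FunctionSpaces.Torus.latticeVec k‖ := by positivity
  exact (pow_le_pow_iff_left₀ hl hr two_ne_zero).1 hsq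

end Concrete

/-! ## §5 The flux in the shape delivered by the weighted Galerkin identity -/

section Flux

variable (K F J : Finset (d → ℤ)) (ω : (d → ℤ) → ℝ) (bhat : (d → ℤ) → EuclideanSpace ℂ d) (X : (d → ℤ) → E)

/-- **The weighted flux in symbol form.**  With the transport coefficients `𝓕(b_a u)(k) = Σ_{j∈J} b̂_{j,a} û(k − j)`
substituted (`PassiveVectorTensorBandFluxShift.mFourierCoeff_trigPoly_smul`), the weighted transport flux
`Σ_k ω_k Re Σ_a 2πi k_a ⟪𝓕(b_a u)(k), û(k)⟫` of the weighted Galerkin identity is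
`Re Σ_k Σ_j ω_k μ_j(k) ⟪û(k−j), û(k)⟫` with `μ_j(k) = 2πi Σ_a k_a conj(b̂_{j,a})`. [cite: DiPernaLions1989, §II.1 Lemma II.1] -/
theorem weightedFlux_eq_re_sum :
    ∑ k ∈ K, ω k * (∑ a, (2 * Real.pi * I * (k a : ℂ)) * ⟪∑ j ∈ J, bhat j a • X (k - j), X k⟫_ℂ).re =
      (∑ k ∈ K, ∑ j ∈ J, ((ω k : ℝ) : ℂ) * (∑ a, 2 * Real.pi * I * (k a : ℂ) * conj (bhat j a)) *
        ⟪X (k - j), X k⟫_ℂ).re := by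
  rw [Complex.re_sum]
  refine Finset.sum_congr rfl fun k _ => ?_
  rw [← Complex.re_ofReal_mul]
  congr 1
  have e : ∀ a, (2 * Real.pi * I * (k a : ℂ)) * ⟪∑ j ∈ J, bhat j a • X (k - j), X k⟫_ℂ =
      ∑ j ∈ J, 2 * Real.pi * I * (k a : ℂ) * conj (bhat j a) * ⟪X (k - j), X k⟫_ℂ := by
    intro a
    rw [sum_inner, Finset.mul_sum]
    refine Finset.sum_congr rfl fun j _ => ?_
    rw [inner_smul_left]
    ring
  rw [Finset.sum_congr rfl fun a _ => e a, Finset.sum_comm]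
  simp only [Finset.mul_sum, Finset.sum_mul]
  refine Finset.sum_congr rfl fun j _ => Finset.sum_congr rfl fun a _ => ?_
  ring

/-- **The symmetrised flux identity, Galerkin shape.**  For a real (`b̂_{−j} = conj b̂_j`), lattice-divergence-free
(`Σ_a j_a b̂_{j,a} = 0`) drift supported in `J = −J`, a real weight supported in `F` and `K ⊇ F ∪ (F + J)`:
`Σ_k ω_k Re Σ_a 2πi k_a ⟪Σ_j b̂_{j,a} • û(k−j), û(k)⟫ = ½ Re Σ_k Σ_j (ω_k − ω_{k−j}) μ_j(k) ⟪û(k−j), û(k)⟫`.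
[cite: ConstantinFoias1988, Ch. 6 (6.15)–(6.17)] -/
theorem weightedFlux_eq_half (hω : ∀ k, ω k ≠ 0 → k ∈ F) (hFK : F ⊆ K)
    (hKJ : ∀ k ∈ F, ∀ j ∈ J, k + j ∈ K) (hJ : ∀ j ∈ J, -j ∈ J)
    (hreal : ∀ j ∈ J, ∀ a, bhat (-j) a = conj (bhat j a)) (hdiv : ∀ j ∈ J, ∑ a, (j a : ℂ) * bhat j a = 0) :
    ∑ k ∈ K, ω k * (∑ a, (2 * Real.pi * I * (k a : ℂ)) * ⟪∑ j ∈ J, bhat j a • X (k - j), X k⟫_ℂ).re =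
      1 / 2 * (∑ k ∈ K, ∑ j ∈ J, ((ω k - ω (k - j) : ℝ) : ℂ) *
        (∑ a, 2 * Real.pi * I * (k a : ℂ) * conj (bhat j a)) * ⟪X (k - j), X k⟫_ℂ).re := by
  rw [weightedFlux_eq_re_sum]
  exact re_sum_eq_half K F J ω (fun j k => ∑ a, 2 * Real.pi * I * (k a : ℂ) * conj (bhat j a)) X hω hFK hKJ hJ
    (fun j hj k => transportSymbol_sub bhat (hdiv j hj) k) (fun j hj k => transportSymbol_neg bhat (hreal j hj) k)

variable [DecidableEq d]

/-- **THE WEIGHTED-FLUX BOUND** (engine of dissipation-weighted Lyapunov functionals for advection–diffusion on `𝕋^d`).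
For a real, lattice-divergence-free drift supported in `J = −J`, a real weight supported in `F` that is `Λ`-Lipschitz in
`|k|²` (`|ω_k − ω_{k′}| ≤ Λ ||k|² − |k′|²|`), and `K ⊇ F ∪ (F + J)`:
`|Σ_{k∈K} ω_k Re Σ_a 2πi k_a ⟪Σ_{j∈J} b̂_{j,a} • û(k−j), û(k)⟫| ≤ Λ · (2π Σ_{j∈J} |j| ‖b̂_j‖) · Σ_{k∈K} |k|² ‖û(k)‖²`
— (Lipschitz constant of the weight on the dissipation scale) × (gradient Wiener norm of the drift) × (`H¹` energy).
[cite: DiPernaLions1989, §II.1 Lemma II.1] [cite: ConstantinFoias1988, Ch. 6 (6.15)–(6.17)] -/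
theorem abs_weightedFlux_le (hω : ∀ k, ω k ≠ 0 → k ∈ F) (hFK : F ⊆ K)
    (hKJ : ∀ k ∈ F, ∀ j ∈ J, k + j ∈ K) (hJ : ∀ j ∈ J, -j ∈ J)
    (hreal : ∀ j ∈ J, ∀ a, bhat (-j) a = conj (bhat j a)) (hdiv : ∀ j ∈ J, ∑ a, (j a : ℂ) * bhat j a = 0)
    {Λ : ℝ} (hΛ : 0 ≤ Λ)
    (hωL : ∀ k k', |ω k - ω k'| ≤
      Λ * |‖FunctionSpaces.Torus.latticeVec k‖ ^ 2 - ‖FunctionSpaces.Torus.latticeVec k'‖ ^ 2|) :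
    |∑ k ∈ K, ω k * (∑ a, (2 * Real.pi * I * (k a : ℂ)) * ⟪∑ j ∈ J, bhat j a • X (k - j), X k⟫_ℂ).re| ≤
      Λ * (2 * Real.pi * ∑ j ∈ J, ‖FunctionSpaces.Torus.latticeVec j‖ * ‖bhat j‖) *
        ∑ k ∈ K, ‖FunctionSpaces.Torus.latticeVec k‖ ^ 2 * ‖X k‖ ^ 2 := by
  rw [weightedFlux_eq_re_sum]
  exact abs_re_sum_le_of_lipschitz_sq K F J ω (fun j k => ∑ a, 2 * Real.pi * I * (k a : ℂ) * conj (bhat j a)) X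
    hω hFK hKJ hJ (fun j hj k => transportSymbol_sub bhat (hdiv j hj) k)
    (fun j hj k => transportSymbol_neg bhat (hreal j hj) k) hΛ hωL (fun j => ‖bhat j‖) (fun j _ => norm_nonneg _)
    (fun j _ k => norm_transportSymbol_le bhat j k)

end Flux

end LatticeFlux

end Literature.Analysis.Fourier

end
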